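import Summits.NavierStokesRegularity.FluidComputer.ClayBlowupSerrin
import Literature.Analysis.FluidPDE.EnstrophyForcingDevice
import Literature.Analysis.FluidPDE.GradientRegularityCriteriaProofs
import HarnessLib

/-!
# BEIRÃO DA VEIGA'S GRADIENT SCALE AND MILLER'S MIDDLE EIGENVALUE WITH THE CLAY FORCE: the strain rows
# of EVERY Clay blow-up (the (C) type), no `f = 0` hypothesis

Cell `ns-blowup`, seat `ns-blowup-ecbridge-2` (g9; the E–C endpoint theory seat). LABEL: E–C typing
(KERNEL — no named fact). WHAT THIS IS NOT: not Navier–Stokes evidence — necessary conditions on the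
TYPE `ClayBlowup ν` (no inhabitant is claimed anywhere), hence — by
`navierStokesBreakdownR3_iff_exists_nonempty_clayBlowup` — on every breakdown scenario for Fefferman's
(C). Companion memo: `run/shared/lean/pub/ns-blowup/ecbridge2/ECBRIDGE-2-MEMO-8.md`.

## Content

g8's `ClayBlowupVorticityCriteria.lean` carried these two rows only for UNFORCED inhabitants
(`hf : X.f = 0`, via the unforced discharges on the Leray–Hopf completion). The Literature file
`EnstrophyForcingDevice` adds the force to the two enstrophy inequalities (the viscosity-splitting device
of Lemarié-Rieusset's Thm. 11.2); fed the Tao-class re-pressurisation on closed sub-slabs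
(`exists_taoPressure`), the Clay-force slice bounds (`force_iteratedFDeriv_slices`,
`exists_force_slice_bounds`) and the `H¹` alternative (`not_exists_enstrophy_bound`), exactly as the
Sohr corner was obtained in `ClayBlowupSerrin`, this gives for EVERY `X : ClayBlowup ν`, `ν > 0`:

* `ClayBlowup.enstrophy_le_of_gradient_forced`, **`ClayBlowup.lintegral_gradient_eq_top_forced`** —
  `∫₀ᵀ ‖∇u(t)‖_{L^r}^{q} dt = ∞` for every `3/2 < r < ∞`, `q = 1/(1 − 3/(2r))` (`2/q + 3/r = 2`),
  and **`ClayBlowup.gradient_not_memLqLp_forced`** — BEIRÃO DA VEIGA WITH THE CLAY FORCE: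
  `∇u ∉ L^q_t L^r_x((0,T) × ℝ³)` for `1 < q < ∞`, `2/q + 3/r = 2`;
* `ClayBlowup.enstrophy_le_of_midStrain_forced`, **`ClayBlowup.middleEigenvalue_not_integrable_forced`**
  — MILLER WITH THE CLAY FORCE: no nonnegative two-frame majorant `m` of the middle principal strain has
  `∫₀ᵀ (∫ m^q)^{2/(2q−3)} < ∞`, `q > 3/2`;
* the `DesignedBlowup` twins and the (C)-reading `breakdownR3_strain`.

References: H. Beirão da Veiga 1995 / Berselli–Galdi 2002 (1.3) [cite: BerselliGaldi2002, (1.3) p. 3586];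
E. Miller 2020, Thm. 1.1 [cite: Miller2019, Thm 1.1]; Lemarié-Rieusset 2016, Thm. 11.2
[cite: LemarieRieusset2016, Thm. 11.2 (11.11)]; Fefferman (C) [cite: FeffermanClay2006, (C)];
Tao 2013, Thm. 5.4 [cite: Tao2011, Thm. 5.4 (ii)+(iv)].
-/

noncomputable section

namespace Summit.NavierStokesRegularity.FluidComputer

open Set MeasureTheory Filter Topology Function
open scoped ENNReal ContDiff NNReal RealInnerProductSpace
open Literature.Analysis.FluidPDE
open Summit.NavierStokesRegularity.NavierStokesRegularity
open Summit.NavierStokesRegularity.FluidComputer.PalasekTowerClayBridge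

namespace ClayBlowup

variable {ν : ℝ} (X : ClayBlowup ν)

/-! ## §1 Beirão da Veiga with the Clay force -/

set_option maxHeartbeats 800000 in
/-- **Beirão da Veiga finiteness ⇒ uniform enstrophy bound on `[0, T)`, for ANY Clay blow-up**
(`ν > 0`, `3/2 < r < ∞`, time exponent `q = 1/(1 − 3/(2 r.toReal))`; no `f = 0` hypothesis, no named
fact): the forced Beirão da Veiga inequality `bdv_enstrophy_le_mul_exp_forced` on each closed sub-slab
`[0, s]` with the Tao-class pressure of `exists_taoPressure` there; the bound does not depend on `s`.
[cite: BerselliGaldi2002, (1.3) p. 3586] [cite: LemarieRieusset2016, Thm. 11.2 (11.11)] -/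
theorem enstrophy_le_of_gradient_forced (hν : 0 < ν) {r : ℝ≥0∞} (hr : 3 / 2 < r) (hrtop : r ≠ ⊤)
    (hLr : ∀ᵐ t ∂volume, t ∈ Ioo 0 X.T → eLpNorm (fderiv ℝ (X.u t)) r volume < ⊤)
    (hA : ∫⁻ t in Ioo 0 X.T, ENNReal.ofReal
      ((eLpNorm (fderiv ℝ (X.u t)) r volume).toReal ^ (1 / (1 - 3 / (2 * r.toReal)))) ≠ ⊤) :
    ∃ B : ℝ≥0, ∀ s ∈ Ico 0 X.T, ∫⁻ x, ENNReal.ofReal (frobeniusNormSq (fderiv ℝ (X.u s) x)) ≤ B := by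
  have hT := X.T_pos
  set θ : ℝ := 1 - 3 / (2 * r.toReal) with hθ
  -- the force: slice bounds and the constant `L²` majorant
  obtain ⟨C₀, C₁, B, -, hC₀, -, -⟩ :=
    ForcedContinuation.exists_force_slice_bounds X.force_smooth X.force_decay
  set F : ℝ → ℝ≥0∞ := fun _ => (C₀ : ℝ≥0∞) with hF
  have hFm : Measurable F := measurable_const
  have hFT : ∫⁻ t in Ioo 0 X.T, F t ≠ ⊤ := by
    rw [hF, setLIntegral_const, Real.volume_Ioo]
    exact ENNReal.mul_ne_top ENNReal.coe_ne_top ENNReal.ofReal_ne_top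
  -- the exponent and the constant
  have hρ3 : 3 / 2 < r.toReal := by
    have h : ((3 / 2 : ℝ≥0∞)).toReal < r.toReal :=
      (ENNReal.toReal_lt_toReal (ENNReal.div_ne_top (by norm_num) (by norm_num)) hrtop).2 hr
    have h32 : ((3 / 2 : ℝ≥0∞)).toReal = 3 / 2 := by
      rw [ENNReal.toReal_div, ENNReal.toReal_ofNat, ENNReal.toReal_ofNat]
    rw [h32] at h
    exact h
  have hρ0 : 0 < r.toReal := by linarith
  have hθ0 : 0 < θ := by
    rw [hθ, sub_pos, div_lt_one (by positivity)]; linarith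
  have hθ1 : θ < 1 := by
    rw [hθ]; linarith [div_pos (zero_lt_three' ℝ) (by positivity : (0 : ℝ) < 2 * r.toReal)]
  set K : ℝ≥0 := SNormLESNormFDerivOfEqConst (EuclideanSpace ℝ (Fin 3))
    (volume : Measure (EuclideanSpace ℝ (Fin 3))) 2 with hK
  set Cθ : ℝ := θ * (2 * (1 - θ)) ^ ((1 - θ) / θ) * (K : ℝ) ^ (2 * (1 - θ) / θ) with hCθ
  have hCθ0 : 0 ≤ Cθ := by
    have : 0 ≤ 1 - θ := by linarith
    positivity
  have hκ0 : 0 ≤ Cθ * (ν / 2) ^ (1 - 1 / θ) := mul_nonneg hCθ0 (Real.rpow_nonneg (half_pos hν).le _)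
  set AT : ℝ≥0∞ := ∫⁻ t in Ioo 0 X.T, ENNReal.ofReal
    ((eLpNorm (fderiv ℝ (X.u t)) r volume).toReal ^ (1 / θ)) with hAT
  have hATtop : AT ≠ ⊤ := hA
  set Bound : ℝ≥0∞ := ENNReal.ofReal (Real.exp (2 * (Cθ * (ν / 2) ^ (1 - 1 / θ) * AT.toReal))) *
    ((∫⁻ x, ENNReal.ofReal (frobeniusNormSq (fderiv ℝ (X.u 0) x))) +
      (ENNReal.ofReal ν)⁻¹ * ∫⁻ t in Ioo 0 X.T, F t) with hBound
  -- the initial enstrophy is finite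
  obtain ⟨D1, hD1⟩ := X.hasBoundedSobolevNormsOn hν (half_pos hT) (half_lt_self hT) 1
  have h0fin : ∫⁻ x, ENNReal.ofReal (frobeniusNormSq (fderiv ℝ (X.u 0) x)) < ⊤ :=
    (lintegral_frobeniusNormSq_le_three_mul_iteratedFDeriv_one (X.u 0)).trans_lt
      (ENNReal.mul_lt_top (by simp) ((hD1 0 ⟨le_rfl, (half_pos hT).le⟩).trans_lt ENNReal.coe_lt_top))
  have hBtop : Bound ≠ ⊤ := by
    rw [hBound]
    refine ENNReal.mul_ne_top ENNReal.ofReal_ne_top (ENNReal.add_ne_top.2 ⟨h0fin.ne, ?_⟩)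
    exact ENNReal.mul_ne_top (ENNReal.inv_ne_top.2 (by positivity)) hFT
  refine ⟨Bound.toNNReal, fun s hs => ?_⟩
  rw [ENNReal.coe_toNNReal hBtop]
  rcases eq_or_lt_of_le hs.1 with h0 | hs0
  · -- `s = 0`: the exponential factor is `≥ 1`
    rw [← h0, hBound]
    have hexp : (1 : ℝ≥0∞) ≤
        ENNReal.ofReal (Real.exp (2 * (Cθ * (ν / 2) ^ (1 - 1 / θ) * AT.toReal))) := by
      rw [← ENNReal.ofReal_one]
      exact ENNReal.ofReal_le_ofReal (Real.one_le_exp (by positivity))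
    calc ∫⁻ x, ENNReal.ofReal (frobeniusNormSq (fderiv ℝ (X.u 0) x))
        ≤ 1 * ((∫⁻ x, ENNReal.ofReal (frobeniusNormSq (fderiv ℝ (X.u 0) x))) +
            (ENNReal.ofReal ν)⁻¹ * ∫⁻ t in Ioo 0 X.T, F t) := by rw [one_mul]; exact le_self_add
      _ ≤ _ := by gcongr
  · -- `0 < s < T`: the slab inequality on `[0, s]` with the Tao-class pressure there
    obtain ⟨p', hsol, hut, hp⟩ := X.exists_taoPressure hν hs0 hs.2
    have hu : HasBoundedSobolevNormsOn (Icc 0 s) X.u := X.hasBoundedSobolevNormsOn hν hs0 hs.2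
    have hf : ∀ n : ℕ, n ≤ 1 → ∃ C : ℝ≥0, ∀ t ∈ Icc 0 s,
        ∫⁻ x, ‖iteratedFDeriv ℝ n (X.f t) x‖ₑ ^ 2 ≤ C := fun n hn => by
      obtain ⟨C, hC⟩ := X.force_iteratedFDeriv_slices n hn
      exact ⟨C, fun t ht => hC t ht.1⟩
    have hsub : Ioo 0 s ⊆ Ioo 0 X.T := Ioo_subset_Ioo le_rfl hs.2.le
    have hAs : ∫⁻ t in Ioo 0 s, ENNReal.ofReal
        ((eLpNorm (fderiv ℝ (X.u t)) r volume).toReal ^ (1 / θ)) ≤ AT := lintegral_mono_set hsub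
    have hFs : ∫⁻ t in Ioo 0 s, F t ≤ ∫⁻ t in Ioo 0 X.T, F t := lintegral_mono_set hsub
    have hLrs : ∀ᵐ t ∂volume, t ∈ Ioo 0 s → eLpNorm (fderiv ℝ (X.u t)) r volume < ⊤ := by
      filter_upwards [hLr] with t ht hts
      exact ht (hsub hts)
    have h := bdv_enstrophy_le_mul_exp_forced hν hs0 hsol hu hut hp hf F hFm
      (fun t ht => hC₀ t ht.1.le) hr hrtop hθ ⟨hs0, le_rfl⟩ hLrs (ne_top_of_le_ne_top hA hAs)
      (ne_top_of_le_ne_top hFT hFs)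
    refine h.trans ?_
    rw [hBound]
    have hexp : Real.exp (2 * (Cθ * (ν / 2) ^ (1 - 1 / θ) *
          (∫⁻ t in Ioo 0 s, ENNReal.ofReal
            ((eLpNorm (fderiv ℝ (X.u t)) r volume).toReal ^ (1 / θ))).toReal)) ≤
        Real.exp (2 * (Cθ * (ν / 2) ^ (1 - 1 / θ) * AT.toReal)) :=
      Real.exp_le_exp.2 (mul_le_mul_of_nonneg_left
        (mul_le_mul_of_nonneg_left (ENNReal.toReal_mono hA hAs) hκ0) zero_le_two)
    gcongr

/-- **BEIRÃO DA VEIGA WITH THE CLAY FORCE, integral form**: `∫₀ᵀ ‖∇u(t)‖_{L^r}^{1/(1−3/(2r))} dt = ∞`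
for every `3/2 < r < ∞`, for EVERY Clay blow-up whose gradient slices are in `L^r` for a.e. time
(`ν > 0`; no named fact). [cite: BerselliGaldi2002, (1.3) p. 3586] -/
theorem lintegral_gradient_eq_top_forced (hν : 0 < ν) {r : ℝ≥0∞} (hr : 3 / 2 < r) (hrtop : r ≠ ⊤)
    (hLr : ∀ᵐ t ∂volume, t ∈ Ioo 0 X.T → eLpNorm (fderiv ℝ (X.u t)) r volume < ⊤) :
    ∫⁻ t in Ioo 0 X.T, ENNReal.ofReal
      ((eLpNorm (fderiv ℝ (X.u t)) r volume).toReal ^ (1 / (1 - 3 / (2 * r.toReal)))) = ⊤ := by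
  by_contra hA
  obtain ⟨B, hB⟩ := X.enstrophy_le_of_gradient_forced hν hr hrtop hLr hA
  exact X.not_exists_enstrophy_bound hν ⟨B, hB⟩

/-- **BEIRÃO DA VEIGA WITH THE CLAY FORCE, FOR EVERY CLAY BLOW-UP: `∇u ∉ L^q_t L^r_x((0,T) × ℝ³)`
whenever `1 < q < ∞`, `2/q + 3/r = 2`** (`ν > 0`; no `f = 0` hypothesis, no named fact). Supersedes the
unforced row `gradient_not_memLqLp` of `ClayBlowupVorticityCriteria`.
[cite: BerselliGaldi2002, (1.3) p. 3586] -/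
theorem gradient_not_memLqLp_forced (hν : 0 < ν) {q r : ℝ≥0∞} (h1q : 1 < q) (hq : q < ⊤)
    (hqr : 2 / q + 3 / r = 2) :
    ¬ MemLqLp q r (fun t x => fderiv ℝ (X.u t) x) (Ioo 0 X.T) := by
  intro hmem
  obtain ⟨hrtop, hr, -⟩ := bdv_exponents h1q hq hqr
  obtain ⟨hA, hLr⟩ := lintegral_ofReal_rpow_gradient_lt_top h1q hq hqr hmem
  exact absurd (X.lintegral_gradient_eq_top_forced hν hr hrtop hLr) hA.ne

/-! ## §2 Miller's middle eigenvalue with the Clay force -/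

set_option maxHeartbeats 800000 in
/-- **Middle-strain finiteness ⇒ uniform enstrophy bound on `[0, T)`, for ANY Clay blow-up**
(`ν > 0`, `q > 3/2`; no `f = 0` hypothesis, no named fact): the forced Miller inequality
`miller_enstrophy_le_mul_exp_forced` on each closed sub-slab `[0, s]` with the Tao-class pressure there.
[cite: Miller2019, Thm 1.1] [cite: LemarieRieusset2016, Thm. 11.2 (11.11)] -/
theorem enstrophy_le_of_midStrain_forced (hν : 0 < ν) {q : ℝ} (hq : 3 / 2 < q)
    {m : ℝ → EuclideanSpace ℝ (Fin 3) → ℝ} (hm0 : ∀ t x, 0 ≤ m t x)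
    (hdom : ∀ t ∈ Ico 0 X.T, ∀ x, ∃ v w : EuclideanSpace ℝ (Fin 3),
      ‖v‖ = 1 ∧ ‖w‖ = 1 ∧ inner ℝ v w = 0 ∧
        ∀ α β : ℝ, inner ℝ (fderiv ℝ (X.u t) x (α • v + β • w)) (α • v + β • w)
          ≤ m t x * (α ^ 2 + β ^ 2))
    (hA : ∫⁻ t in Ioo 0 X.T, (∫⁻ x, ENNReal.ofReal (m t x) ^ q) ^ (2 / (2 * q - 3)) ≠ ⊤) :
    ∃ B : ℝ≥0, ∀ s ∈ Ico 0 X.T, ∫⁻ x, ENNReal.ofReal (frobeniusNormSq (fderiv ℝ (X.u s) x)) ≤ B := by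
  have hT := X.T_pos
  set θ : ℝ := 1 - 3 / (2 * q) with hθ
  -- the force: slice bounds and the constant `L²` majorant
  obtain ⟨C₀, C₁, B, -, hC₀, -, -⟩ :=
    ForcedContinuation.exists_force_slice_bounds X.force_smooth X.force_decay
  set F : ℝ → ℝ≥0∞ := fun _ => (C₀ : ℝ≥0∞) with hF
  have hFm : Measurable F := measurable_const
  have hFT : ∫⁻ t in Ioo 0 X.T, F t ≠ ⊤ := by
    rw [hF, setLIntegral_const, Real.volume_Ioo]
    exact ENNReal.mul_ne_top ENNReal.coe_ne_top ENNReal.ofReal_ne_top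
  -- the exponent and the constant
  have hρ0 : 0 < q := by linarith
  have hθ0 : 0 < θ := by
    rw [hθ, sub_pos, div_lt_one (by positivity)]; linarith
  have hθ1 : θ < 1 := by
    rw [hθ]; linarith [div_pos (zero_lt_three' ℝ) (by positivity : (0 : ℝ) < 2 * q)]
  set K : ℝ≥0 := SNormLESNormFDerivOfEqConst (EuclideanSpace ℝ (Fin 3))
    (volume : Measure (EuclideanSpace ℝ (Fin 3))) 2 with hK
  set Cθ : ℝ := θ * (2 * (1 - θ)) ^ ((1 - θ) / θ) * (K : ℝ) ^ (2 * (1 - θ) / θ) * (2 : ℝ) ^ (1 / θ)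
    with hCθ
  have hCθ0 : 0 ≤ Cθ := by
    have : 0 ≤ 1 - θ := by linarith
    positivity
  have hκ0 : 0 ≤ (Cθ + 1) * (ν / 2) ^ (1 - 1 / θ) := by positivity
  set AT : ℝ≥0∞ := ∫⁻ t in Ioo 0 X.T, (∫⁻ x, ENNReal.ofReal (m t x) ^ q) ^ (2 / (2 * q - 3)) with hAT
  set Bound : ℝ≥0∞ := ENNReal.ofReal (Real.exp (2 * ((Cθ + 1) * (ν / 2) ^ (1 - 1 / θ) * AT.toReal))) *
    ((∫⁻ x, ENNReal.ofReal (frobeniusNormSq (fderiv ℝ (X.u 0) x))) +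
      (ENNReal.ofReal ν)⁻¹ * ∫⁻ t in Ioo 0 X.T, F t) with hBound
  obtain ⟨D1, hD1⟩ := X.hasBoundedSobolevNormsOn hν (half_pos hT) (half_lt_self hT) 1
  have h0fin : ∫⁻ x, ENNReal.ofReal (frobeniusNormSq (fderiv ℝ (X.u 0) x)) < ⊤ :=
    (lintegral_frobeniusNormSq_le_three_mul_iteratedFDeriv_one (X.u 0)).trans_lt
      (ENNReal.mul_lt_top (by simp) ((hD1 0 ⟨le_rfl, (half_pos hT).le⟩).trans_lt ENNReal.coe_lt_top))
  have hBtop : Bound ≠ ⊤ := by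
    rw [hBound]
    refine ENNReal.mul_ne_top ENNReal.ofReal_ne_top (ENNReal.add_ne_top.2 ⟨h0fin.ne, ?_⟩)
    exact ENNReal.mul_ne_top (ENNReal.inv_ne_top.2 (by positivity)) hFT
  refine ⟨Bound.toNNReal, fun s hs => ?_⟩
  rw [ENNReal.coe_toNNReal hBtop]
  rcases eq_or_lt_of_le hs.1 with h0 | hs0
  · rw [← h0, hBound]
    have hexp : (1 : ℝ≥0∞) ≤
        ENNReal.ofReal (Real.exp (2 * ((Cθ + 1) * (ν / 2) ^ (1 - 1 / θ) * AT.toReal))) := by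
      rw [← ENNReal.ofReal_one]
      exact ENNReal.ofReal_le_ofReal (Real.one_le_exp (by positivity))
    calc ∫⁻ x, ENNReal.ofReal (frobeniusNormSq (fderiv ℝ (X.u 0) x))
        ≤ 1 * ((∫⁻ x, ENNReal.ofReal (frobeniusNormSq (fderiv ℝ (X.u 0) x))) +
            (ENNReal.ofReal ν)⁻¹ * ∫⁻ t in Ioo 0 X.T, F t) := by rw [one_mul]; exact le_self_add
      _ ≤ _ := by gcongr
  · obtain ⟨p', hsol, hut, hp⟩ := X.exists_taoPressure hν hs0 hs.2
    have hu : HasBoundedSobolevNormsOn (Icc 0 s) X.u := X.hasBoundedSobolevNormsOn hν hs0 hs.2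
    have hf : ∀ n : ℕ, n ≤ 1 → ∃ C : ℝ≥0, ∀ t ∈ Icc 0 s,
        ∫⁻ x, ‖iteratedFDeriv ℝ n (X.f t) x‖ₑ ^ 2 ≤ C := fun n hn => by
      obtain ⟨C, hC⟩ := X.force_iteratedFDeriv_slices n hn
      exact ⟨C, fun t ht => hC t ht.1⟩
    have hsub : Ioo 0 s ⊆ Ioo 0 X.T := Ioo_subset_Ioo le_rfl hs.2.le
    have hAs : ∫⁻ t in Ioo 0 s, (∫⁻ x, ENNReal.ofReal (m t x) ^ q) ^ (2 / (2 * q - 3)) ≤ AT :=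
      lintegral_mono_set hsub
    have hFs : ∫⁻ t in Ioo 0 s, F t ≤ ∫⁻ t in Ioo 0 X.T, F t := lintegral_mono_set hsub
    have hmaj : ∀ t ∈ Ioo 0 s, ∀ x, ∃ y z : EuclideanSpace ℝ (Fin 3), ‖y‖ = 1 ∧ ‖z‖ = 1 ∧
        inner ℝ y z = 0 ∧ ∀ α β : ℝ,
          inner ℝ (fderiv ℝ (X.u t) x (α • y + β • z)) (α • y + β • z) ≤ m t x * (α ^ 2 + β ^ 2) :=
      fun t ht x => hdom t ⟨ht.1.le, ht.2.trans hs.2⟩ x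
    have h := miller_enstrophy_le_mul_exp_forced hν hs0 hsol hu hut hp hf F hFm
      (fun t ht => hC₀ t ht.1.le) hq hθ hm0 ⟨hs0, le_rfl⟩ hmaj (ne_top_of_le_ne_top hA hAs)
      (ne_top_of_le_ne_top hFT hFs)
    refine h.trans ?_
    rw [hBound]
    have hexp : Real.exp (2 * ((Cθ + 1) * (ν / 2) ^ (1 - 1 / θ) *
          (∫⁻ t in Ioo 0 s, (∫⁻ x, ENNReal.ofReal (m t x) ^ q) ^ (2 / (2 * q - 3))).toReal)) ≤
        Real.exp (2 * ((Cθ + 1) * (ν / 2) ^ (1 - 1 / θ) * AT.toReal)) :=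
      Real.exp_le_exp.2 (mul_le_mul_of_nonneg_left
        (mul_le_mul_of_nonneg_left (ENNReal.toReal_mono hA hAs) hκ0) zero_le_two)
    gcongr

/-- **MILLER'S MIDDLE-EIGENVALUE CRITERION WITH THE CLAY FORCE, FOR EVERY CLAY BLOW-UP** (`ν > 0`; no
`f = 0` hypothesis, no named fact): if a nonnegative `m(t, x)` dominates the quadratic form of
`∇u(t, x)` on SOME 2-plane at every `(t, x) ∈ [0, T) × ℝ³` (i.e. `m ≥ λ₂⁺`, the positive part of the
middle eigenvalue of the strain), then `∫₀ᵀ ‖m(t)‖_{L^q}^{2q/(2q−3)} dt = ∞` for every `q > 3/2`.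
Supersedes the unforced row `middleEigenvalue_not_integrable` of `ClayBlowupVorticityCriteria`.
[cite: Miller2019, Thm 1.1] -/
theorem middleEigenvalue_not_integrable_forced (hν : 0 < ν) {q : ℝ} (hq : 3 / 2 < q)
    {m : ℝ → EuclideanSpace ℝ (Fin 3) → ℝ} (hm0 : ∀ t x, 0 ≤ m t x)
    (hdom : ∀ t ∈ Ico 0 X.T, ∀ x, ∃ v w : EuclideanSpace ℝ (Fin 3),
      ‖v‖ = 1 ∧ ‖w‖ = 1 ∧ inner ℝ v w = 0 ∧
        ∀ α β : ℝ, inner ℝ (fderiv ℝ (X.u t) x (α • v + β • w)) (α • v + β • w)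
          ≤ m t x * (α ^ 2 + β ^ 2)) :
    ¬ (∫⁻ t in Ioo 0 X.T, (∫⁻ x, ENNReal.ofReal (m t x) ^ q) ^ (2 / (2 * q - 3)) < ⊤) := by
  intro hfin
  obtain ⟨B, hB⟩ := X.enstrophy_le_of_midStrain_forced hν hq hm0 hdom hfin.ne
  exact X.not_exists_enstrophy_bound hν ⟨B, hB⟩

end ClayBlowup

/-! ## §3 The strong type and the Clay statement -/

namespace DesignedBlowup

variable {ν : ℝ} (D : DesignedBlowup ν)

/-- **Beirão da Veiga with the Clay force for every designed blow-up.**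
[cite: BerselliGaldi2002, (1.3) p. 3586] -/
theorem gradient_not_memLqLp_forced (hν : 0 < ν) {q r : ℝ≥0∞} (h1q : 1 < q) (hq : q < ⊤)
    (hqr : 2 / q + 3 / r = 2) :
    ¬ MemLqLp q r (fun t x => fderiv ℝ (D.u t) x) (Ioo 0 D.T) :=
  D.toClayBlowup.gradient_not_memLqLp_forced hν h1q hq hqr

/-- **Miller with the Clay force for every designed blow-up.** [cite: Miller2019, Thm 1.1] -/
theorem middleEigenvalue_not_integrable_forced (hν : 0 < ν) {q : ℝ} (hq : 3 / 2 < q)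
    {m : ℝ → EuclideanSpace ℝ (Fin 3) → ℝ} (hm0 : ∀ t x, 0 ≤ m t x)
    (hdom : ∀ t ∈ Ico 0 D.T, ∀ x, ∃ v w : EuclideanSpace ℝ (Fin 3),
      ‖v‖ = 1 ∧ ‖w‖ = 1 ∧ inner ℝ v w = 0 ∧
        ∀ α β : ℝ, inner ℝ (fderiv ℝ (D.u t) x (α • v + β • w)) (α • v + β • w)
          ≤ m t x * (α ^ 2 + β ^ 2)) :
    ¬ (∫⁻ t in Ioo 0 D.T, (∫⁻ x, ENNReal.ofReal (m t x) ^ q) ^ (2 / (2 * q - 3)) < ⊤) :=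
  D.toClayBlowup.middleEigenvalue_not_integrable_forced hν hq hm0 hdom

end DesignedBlowup

/-- **EVERY BREAKDOWN SCENARIO FOR (C) LEAVES BEIRÃO DA VEIGA'S GRADIENT SCALE** (no named fact): if
Fefferman's (C) holds then at every `ν > 0` there is a Clay blow-up with `∇u ∉ L^q_t L^r_x((0,T) × ℝ³)`
for all `1 < q < ∞`, `2/q + 3/r = 2`. [cite: FeffermanClay2006, (C)] [cite: BerselliGaldi2002, (1.3) p. 3586] -/
theorem breakdownR3_strain
    (h : Summit.NavierStokesRegularity.NavierStokesRegularity.NavierStokesBreakdownR3)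
    {ν : ℝ} (hν : 0 < ν) :
    ∃ X : ClayBlowup ν, ∀ q r : ℝ≥0∞, 1 < q → q < ⊤ → 2 / q + 3 / r = 2 →
      ¬ MemLqLp q r (fun t x => fderiv ℝ (X.u t) x) (Ioo 0 X.T) := by
  obtain ⟨X⟩ := forall_nonempty_clayBlowup_of_breakdownR3 h ν hν
  exact ⟨X, fun q r h1q hq hqr => X.gradient_not_memLqLp_forced hν h1q hq hqr⟩

end Summit.NavierStokesRegularity.FluidComputer

end
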